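import Mathlib
import Summits.Ventures.PercRepro2.Defs
import Summits.Ventures.PercRepro2.Graph
import Summits.Ventures.PercRepro2.OneColourSwitch
import Summits.Ventures.PercRepro2.RegionHubSign
import Summits.Ventures.PercRepro2.SideSwitch
import Summits.Ventures.PercRepro2.SideSwitchFibre
import Summits.Ventures.PercRepro2.SideSwitchMono
import Summits.Ventures.PercRepro2.SideSwitchClosed
import Summits.Ventures.PercRepro2.SideSwitchComps
import Summits.Ventures.PercRepro2.SideSwitchCompsFibre
import Summits.Ventures.PercRepro2.M9NoPocketDefs
import Summits.Ventures.PercRepro2.M9NoPocketSetDefs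
import Summits.Ventures.PercRepro2.M9NoPocketSetWorld
import Summits.Ventures.PercRepro2.M9NoPocketSetWorldD
import Summits.Ventures.PercRepro2.M9NoPocketSetLegal

/-!
# The multi-`d` class without pockets — monotonicity on the legal vectors (blind cell
PercRepro2, p3 g20, 2026-08-27; `proofs/P3-CPNC.md` §17i (2)); the multi-`d` form of
`M9NoPocketMono`

For legal vectors `x ≤ x'` of a representative: `p ~_Y q` is increasing
(`conn_pq_assignX_mono`), `r ~_Y s` decreasing (`conn_rs_assignX_anti`) and `r ~_W s`
increasing (`conn_rs_compl_assignX_mono`).  The edges that change from `x` to `x'` are the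
touches of the blocks switched in between (on the `A`-side at `x`, hence in the `Y`-world) and
the `T`-edges coloured `W` in between (at `r, s`, never on a `p`–`q` path; `W` at `x'`, never
on a `Y`-path from `r`); the monotone path-transfer lemma `conn_of_le_off_touches` does the
rest.  Own work; std axioms.
-/

namespace Summit.Ventures.PercRepro2

namespace NoPocketSet

open Finset Classical RegionHub OneColourSwitch SideSwitch NoPocket

variable {V : Type*} {E : Type*}

section Mono

variable [Fintype V] [DecidableEq V] [Fintype E] [DecidableEq E]

variable {ends : E → Sym2 V}

omit [Fintype E] in
/-- Two assignments `x ≤ x'` agree on every edge not touching the blocks switched in between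
and not among the `T`-edges coloured `W` in between. -/
lemma assignX_eq_of_le {D : Finset V} {r s : V} {ρ : Config E} {x x' : Finset (Finset V) × Finset E}
    (hxx' : x ≤ x') (_hT' : x'.1 ⊆ blocks ends D r s ρ) {e : E}
    (he : e ∉ touches ends (↑(unionT x'.1 \ unionT x.1) : Set V)) (heF : e ∉ x'.2 \ x.2) :
    assignX ends x ρ e = assignX ends x' ρ e := by
  obtain ⟨hTT, hFF⟩ := hxx'
  have hflip : flipF x.2 ρ e = flipF x'.2 ρ e := by
    by_cases h : e ∈ x.2
    · rw [flipF_of_mem h, flipF_of_mem (hFF h)]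
    · rw [flipF_of_notMem h, flipF_of_notMem (fun h' => heF (Finset.mem_sdiff.2 ⟨h', h⟩))]
  have hmono : unionT x.1 ⊆ unionT x'.1 := unionT_mono hTT
  have key := assign_eq_of_notMem_touches_sdiff (ends := ends) (ω := flipF x'.2 ρ) hmono he
  have h1 : flipTouch ends (↑(unionT x.1) : Set V) (flipF x.2 ρ) e =
      flipTouch ends (↑(unionT x.1) : Set V) (flipF x'.2 ρ) e := by
    simp only [flipTouch, hflip]
  simp only [assignX, assign] at key ⊢
  rw [h1, key]

omit [Fintype V] [DecidableEq V] [Fintype E] [DecidableEq E] in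
/-- The explored set of `X` contains `X`. -/
lemma subset_expl (X : Set V) (ω : Config E) : X ⊆ expl ends X ω :=
  fun y hy => ⟨y, hy, conn_refl _ _ _⟩

omit [Fintype V] [DecidableEq V] [Fintype E] [DecidableEq E] in
/-- The edges touching `X` touch the explored set of `X`. -/
lemma touches_subset_touches_expl (X : Set V) (ω : Config E) :
    touches ends X ⊆ touches ends (expl ends X ω) := by
  rintro e ⟨y, hy, z, hyz⟩
  exact ⟨y, subset_expl X ω hy, z, hyz⟩

omit [Fintype V] [DecidableEq V] [Fintype E] [DecidableEq E] in
/-- The `Y`-world is the explored set of `{r, s}`. -/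
lemma expl_pair_eq_K2 (r s : V) (ω : Config E) :
    expl ends ({r, s} : Set V) ω = K2 ends r s ω := rfl

/-- A switched-in-between block vertex lies in the `Y`-world of the smaller assignment. -/
lemma mem_K2_assignX_of_mem_sdiff {p q r s : V} {D : Finset V} {ρ : Config E} (hρ : ρ ∈ RepD ends p q r s D)
    {x x' : Finset (Finset V) × Finset E} (hxx' : x ≤ x') (hT' : x'.1 ⊆ blocks ends D r s ρ)
    (hF : x.2 ⊆ Tset ends D r s) {y : V} (hy : y ∈ unionT x'.1 \ unionT x.1) :
    y ∈ K2 ends r s (assignX ends x ρ) := by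
  obtain ⟨hyT', hyT⟩ := Finset.mem_sdiff.1 hy
  refine K2_endsD_subset_K2 (D := D) _ ?_
  rw [K2_endsD_assignX hρ (hxx'.1.trans hT') hF]
  exact ⟨unionT_subset_K2_endsD hρ hT' (Finset.mem_coe.2 hyT'), fun h => hyT (Finset.mem_coe.1 h)⟩

/-- (M1) `p ~_Y q` is increasing on the legal vectors. -/
theorem conn_pq_assignX_mono {p q r s : V} {D : Finset V} (hnp : NoPocketAt ends D r s)
    (hind : DIndep ends D) (hpD : p ∉ D) (hqD : q ∉ D) (hDr : ∀ d ∈ D, d ≠ r) (hDs : ∀ d ∈ D, d ≠ s) {ρ : Config E} (hρ : ρ ∈ RepD ends p q r s D)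
    {x x' : Finset (Finset V) × Finset E} (hxx' : x ≤ x') (hx : x ∈ L4 ends D r s ρ)
    (hx' : x' ∈ L4 ends D r s ρ) (hc : Conn ends (assignX ends x ρ) p q) :
    Conn ends (assignX ends x' ρ) p q := by
  obtain ⟨⟨hT, hF⟩, _⟩ := mem_L4.1 hx
  obtain ⟨⟨hT', hF'⟩, _⟩ := mem_L4.1 hx'
  have hsep := (mem_DSubSet.1 (mem_DSubSet_assignX_of_mem_L4 hnp hind hpD hqD hDr hDs hρ hx)).1
  refine conn_of_le_off_touches (X := ({r, s} : Set V)) (ω := assignX ends x ρ)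
    (ω' := assignX ends x' ρ) ?_ ?_ hc
  · rw [expl_pair_eq_K2]
    exact (not_mem_K2_of_sep2 hsep).1
  · intro e he hopen
    rw [expl_pair_eq_K2] at he
    rw [← assignX_eq_of_le hxx' hT' ?_ ?_]
    · exact hopen
    · -- an edge touching a switched block touches the `Y`-world of `x`
      rintro ⟨y, hy, z, hyz⟩
      exact he ⟨y, mem_K2_assignX_of_mem_sdiff hρ hxx' hT' hF (Finset.mem_coe.1 hy), z, hyz⟩
    · -- a `T`-edge touches `r` or `s`
      intro heF
      have heT : e ∈ Tset ends D r s := hF' (Finset.mem_sdiff.1 heF).1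
      obtain ⟨d, _, h⟩ := mem_Tset.1 heT
      rcases h with h | h
      · exact he ⟨r, r_mem_K2 r s _, d, by rw [h, Sym2.eq_swap]⟩
      · exact he ⟨s, s_mem_K2 r s _, d, by rw [h, Sym2.eq_swap]⟩

/-- (M2) `r ~_Y s` is decreasing on the legal vectors. -/
theorem conn_rs_assignX_anti {p q r s : V} {D : Finset V} (hnp : NoPocketAt ends D r s)
    (hind : DIndep ends D) (hpD : p ∉ D) (hqD : q ∉ D) (hDr : ∀ d ∈ D, d ≠ r) (hDs : ∀ d ∈ D, d ≠ s) {ρ : Config E} (hρ : ρ ∈ RepD ends p q r s D)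
    {x x' : Finset (Finset V) × Finset E} (hxx' : x ≤ x') (hx : x ∈ L4 ends D r s ρ)
    (hx' : x' ∈ L4 ends D r s ρ) (hc : Conn ends (assignX ends x' ρ) r s) :
    Conn ends (assignX ends x ρ) r s := by
  obtain ⟨⟨hT, hF⟩, _⟩ := mem_L4.1 hx
  obtain ⟨⟨hT', hF'⟩, _⟩ := mem_L4.1 hx'
  have hD := (mem_DSubSet.1 (mem_DSubSet_assignX_of_mem_L4 hnp hind hpD hqD hDr hDs hρ hx')).2
  refine conn_of_le_off_touches (X := (↑(unionT x'.1 \ unionT x.1) : Set V))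
    (ω := assignX ends x' ρ) (ω' := assignX ends x ρ) ?_ ?_ hc
  · rintro ⟨y, hy, hyr⟩
    have hy' := Finset.mem_coe.1 hy
    have hyT' : y ∈ unionT x'.1 := (Finset.mem_sdiff.1 hy').1
    have hyA := unionT_subset_A0 (ends := endsD ends D r) hT' hyT'
    obtain ⟨_, hyr', hys'⟩ := mem_A0.1 hyA
    have hyd : y ∉ D := fun h =>
      not_mem_K2_endsD h (hDr y h) (hDs y h) ρ
        (A0_subset_K2_of_mem_Rep (mem_Rep_endsD_of_mem_RepD hρ) hyA)
    exact hD y hyr' hys' hyd (mem_K2_iff.2 (Or.inl (conn_symm hyr)))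
      (mem_M2_assignX_of_mem_unionT hρ hT' hF' hyT')
  · intro e he hopen
    have hnt : e ∉ touches ends (↑(unionT x'.1 \ unionT x.1) : Set V) :=
      fun h => he (touches_subset_touches_expl _ _ h)
    by_cases heF : e ∈ x'.2 \ x.2
    · exfalso
      have heT : e ∈ Tset ends D r s := hF' (Finset.mem_sdiff.1 heF).1
      have := (assignX_Tset_eq_false_iff hρ hDr hDs hT' heT).2 (Finset.mem_sdiff.1 heF).1
      rw [this] at hopen
      exact Bool.false_ne_true hopen
    · rw [assignX_eq_of_le hxx' hT' hnt heF]
      exact hopen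

/-- (M3) `r ~_W s` is increasing on the legal vectors. -/
theorem conn_rs_compl_assignX_mono {p q r s : V} {D : Finset V} (hnp : NoPocketAt ends D r s)
    (hind : DIndep ends D) (hpD : p ∉ D) (hqD : q ∉ D) (hDr : ∀ d ∈ D, d ≠ r) (hDs : ∀ d ∈ D, d ≠ s) {ρ : Config E} (hρ : ρ ∈ RepD ends p q r s D)
    {x x' : Finset (Finset V) × Finset E} (hxx' : x ≤ x') (hx : x ∈ L4 ends D r s ρ)
    (hx' : x' ∈ L4 ends D r s ρ)
    (hc : Conn ends (OneColourSwitch.compl (assignX ends x ρ)) r s) :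
    Conn ends (OneColourSwitch.compl (assignX ends x' ρ)) r s := by
  obtain ⟨⟨hT, hF⟩, _⟩ := mem_L4.1 hx
  obtain ⟨⟨hT', hF'⟩, _⟩ := mem_L4.1 hx'
  have hD := (mem_DSubSet.1 (mem_DSubSet_assignX_of_mem_L4 hnp hind hpD hqD hDr hDs hρ hx)).2
  refine conn_of_le_off_touches (X := (↑(unionT x'.1 \ unionT x.1) : Set V))
    (ω := OneColourSwitch.compl (assignX ends x ρ))
    (ω' := OneColourSwitch.compl (assignX ends x' ρ)) ?_ ?_ hc
  · rintro ⟨y, hy, hyr⟩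
    have hy' := Finset.mem_coe.1 hy
    have hyT' : y ∈ unionT x'.1 := (Finset.mem_sdiff.1 hy').1
    have hyA := unionT_subset_A0 (ends := endsD ends D r) hT' hyT'
    obtain ⟨_, hyr', hys'⟩ := mem_A0.1 hyA
    have hyd : y ∉ D := fun h =>
      not_mem_K2_endsD h (hDr y h) (hDs y h) ρ
        (A0_subset_K2_of_mem_Rep (mem_Rep_endsD_of_mem_RepD hρ) hyA)
    exact hD y hyr' hys' hyd (mem_K2_assignX_of_mem_sdiff hρ hxx' hT' hF hy')
      (mem_M2_iff.2 (Or.inl (conn_symm hyr)))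
  · intro e he hopen
    have hnt : e ∉ touches ends (↑(unionT x'.1 \ unionT x.1) : Set V) :=
      fun h => he (touches_subset_touches_expl _ _ h)
    by_cases heF : e ∈ x'.2 \ x.2
    · exfalso
      obtain ⟨heF', heFx⟩ := Finset.mem_sdiff.1 heF
      have heT : e ∈ Tset ends D r s := hF' heF'
      have := (assignX_Tset_eq_true_iff hρ hDr hDs hT heT).2 heFx
      simp only [OneColourSwitch.compl, this] at hopen
      exact Bool.false_ne_true hopen
    · simp only [OneColourSwitch.compl] at hopen ⊢
      rw [← assignX_eq_of_le hxx' hT' hnt heF]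
      exact hopen

end Mono

end NoPocketSet

end Summit.Ventures.PercRepro2
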